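import Literature.AlgebraicGeometry.Resolution.WeightedCentreFaceCore
import Literature.AlgebraicGeometry.Resolution.WeightedCentreFacePure
import Literature.AlgebraicGeometry.Resolution.WeightedCentreFaceNoFlow
import HarnessLib

/-!
# Weighted centres — COROLLARY L-F for a menu with ONE light class, modulo the A⁺ output

Instrument for engine 1's `W(f)` TOY MODEL (cell `pub-rosobs`, LF-MODEL-eng1-g45 §6.2 REDUCTION + §6.4 COROLLARY L-F in the case of a single light weight class; the general
case iterates the same storey), NOT a resolution theorem and NOT about the invariant of [AbramovichTemkinWlodarczyk2024].

`ZKernel.eq_one_of_one_light_class`: `k` perfect of characteristic `p`, `n!·u_n = 1 (n < p)`, positive weights, `Z` = the set of ALL light slots (weight `< p`) with a positive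
lower weight bound `ζ`, `g` `w`-homogeneous of weight `p(p+1)`, (P) at every slot of weight `≤ p + 1`, `V ⊇` the slots heavier than `p + 1`, all of weight `> p + 1`.  Then every
`A ∈ isoFix w Z V g = graded ⊓ baseFixing ⊓ 𝔄_1 ⊓ fixSlots Z ⊓ fixSlots V ⊓ Stab(C g)` (membership in `fixSlots Z` is THEOREM A⁺'s output, `WeightedCentreTheoremAPlusClass`,
taken here as part of the hypothesis) WITHOUT pure `σ^p`-term on the `W`-slots is trivial.  Proof = one storey of the tower: `restrictFace` is injective (THEOREM B with
THEOREM 𝔉′ as `hN`), its image lies in the core face's isotropy group with the same pure `σ^p`-coefficients ((KL iii)), and THEOREM F★ at the core (`eq_one_of_core`) kills it.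

References: [AbramovichTemkinWlodarczyk2024, §5.1 (p. 1575), Thm. 5.3.1 (2)–(3) (p. 1578)]; [Lang2002, Ch. I §3, Ch. IV §1, Ch. XIII §4]; [Matsumura1987, §27 (pp. 207–209)].
-/

namespace Literature.AlgebraicGeometry.Resolution.WeightedBlowup.ZKernel

open Polynomial OrderFiltration LevelProjection Truncation TailedLightFlow

variable {k : Type*} [Field k] {ι : Type*} [Fintype ι] [DecidableEq ι] (p : ℕ) [Fact p.Prime] [CharP k p] {u : ℕ → k}

/-- **COROLLARY L-F, ONE LIGHT CLASS, modulo A⁺** (LF-MODEL §6.2 REDUCTION / §6.4 for a single light class): see the module docstring.  Instrument for engine 1's `W(f)` toy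
model, NOT a resolution theorem. [cite: AbramovichTemkinWlodarczyk2024, §5.1 (p. 1575), Thm. 5.3.1 (2)–(3) (p. 1578); Lang2002, Ch. XIII §4; Matsumura1987, §27 (pp. 207–209)] -/
theorem eq_one_of_one_light_class (hperf : ∀ x : k, ∃ y : k, y ^ p = x) (hu : ∀ n < p, (Nat.factorial n : k) * u n = 1)
    {w : ι → ℚ} (hw : ∀ i, 0 < w i) (Z : Set ι) [DecidablePred (· ∈ Z)] (hZ : ∀ j, j ∈ Z ↔ w j < p) {ζ : ℚ} (hζ : 0 < ζ) (hZζ : ∀ z ∈ Z, ζ ≤ w z)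
    {g : MvPolynomial ι k} (hg : MvPolynomial.IsWeightedHomogeneous w g ((p : ℚ) * (p + 1))) (hP : ∀ l, w l ≤ (p : ℚ) + 1 → SlotPinned w l g)
    {V : Set ι} (hVw : ∀ i, w i ≤ (p : ℚ) + 1 ∨ i ∈ V) (hwV : ∀ i ∈ V, (p : ℚ) + 1 < w i) (A : isoFix w Z V g)
    (hW : ∀ n, w n = p → pureCoeff ((A : (MvPolynomial ι k)[X] ≃+* (MvPolynomial ι k)[X]) : (MvPolynomial ι k)[X] →+* (MvPolynomial ι k)[X]) n p = 0) :
    A = 1 := by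
  have hp : 1 < p := (Fact.out : p.Prime).one_lt
  have hN : NoTailedLightFlow p u w g := noTailedLightFlow hu hp hw hP
  have hinj := restrictFace_injective p hu (fun i => (hw i).le) hZζ hζ (fun z hz => by exact_mod_cast (hZ z).mp hz) hVw hwV hN
  -- the image `B` of `A` on the core face is trivial
  have hB : restrictFace w Z V g A = 1 := by
    have hwF : ∀ j : {j : ι // j ∉ Z}, (p : ℚ) ≤ (w ∘ Subtype.val) j := fun j => not_lt.mp fun h => j.2 ((hZ j.1).mpr h)
    have hZ' : ∀ j ∈ Z, ∀ l ∉ Z, w j < w l := fun j hj l hl =>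
      lt_of_lt_of_le ((hZ j).mp hj) (not_lt.mp fun h => hl ((hZ l).mpr h))
    refine eq_one_of_core p hperf hwF (isWeightedHomogeneous_killCompl Z hg) (restrictFace_mem_graded (fun i => (hw i).le) A)
      (restrictFace_mem_baseFixing A) (restrictFace_mem_level_one A) (restrictFace_C_face A) (fun j hj => ?_) (fun n hn => ?_)
      (fun i hi => slotPinned_face Z hP hZ' i (le_of_eq hi))
    · exact restrictFace_mem_fixSlots A j ((hVw j.1).resolve_left (not_le.mpr hj))
    · rw [← RingEquiv.toRingHom_eq_coe, pureCoeff_restrictFace, RingEquiv.toRingHom_eq_coe]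
      exact hW n.1 hn
  exact hinj (by rw [hB, map_one])

end Literature.AlgebraicGeometry.Resolution.WeightedBlowup.ZKernel
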